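import Summits.QuantumFields.YangMills.Theorems.LuscherReductionOneSiteLevelsKacHeat
import Summits.QuantumFields.YangMills.Theorems.LuscherReductionOneSiteLevelsKacClass

/-!
# INNER, flat lane (layer III): Gaussian smoothing of Lüscher's potential and the Jensen transfer

Support module of crux `OneSiteLevels` (route `LuscherReduction`, item stmt-QuantumFields-20007), FLAT lane of the
registered v12 stub `stub_flatKacAL1` (STUB-PLAN rev 3 row III.3, sloppy-constant form).

* §1 even Gaussian moments of the heat kernel on `ZM = ℝ⁹`: `∫ G_τ(z) ‖z‖^{2k} dz ≤ 32 · k! · (8τ)^k`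
  (`s^k/k! ≤ e^s`, and `(4πτ)^{−9/2} e^{−‖z‖²/(8τ)}` has mass `2^{9/2} ≤ 32`).
* §2 the second difference of the potential: `V(y+z) + V(y−z) − 2V(y) ≤ 3‖y‖²‖z‖² + ½‖z‖⁴`
  (from `4V(x) = ‖x‖⁴ − Σ_{ij}(x_i·x_j)²` and `Σ_{ij}(y_i·y_j)(z_i·z_j) = Σ_{ab}(Σ_i y_{ia}z_{ib})² ≥ 0`).
* §3 `heatSmooth_potential_le`: `(P_s V)(y) ≤ V(y) + 192 s ‖y‖² + 256 s²` (symmetrised Gaussian average; any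
  constants would do downstream — they are absorbed by the choice of the spectral window).
(Jensen and the transfer `∫ V (P_s r)² ≤ ∫ (V + 192 s‖·‖² + 256 s²) r²`: companion file `…KacPotentialTransfer.lean`.)

Real analysis only ([folklore]); NOT the stub; femto rung R2b1; NOT a claim about the gap.
-/

set_option autoImplicit false

noncomputable section

open MeasureTheory Filter Topology Real
open Literature.Analysis.OperatorTheory.YMMatrixModel

namespace Summit.QuantumFields.YangMills.Theorems.FemtoTransferGap

/-! ### §1. Even Gaussian moments -/

section Moments

open Literature.Analysis.UnboundedOperators in
/-- Pointwise: `‖z‖^{2k} G_τ(z) ≤ k!(8τ)^k · (4πτ)^{−9/2} e^{−‖z‖²/(8τ)}` (`s^k/k! ≤ e^s` at `s = ‖z‖²/(8τ)`). [folklore] -/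
theorem norm_pow_mul_heatKernelUO_le {τ : ℝ} (hτ : 0 < τ) (k : ℕ) (z : ZM) :
    ‖z‖ ^ (2 * k) * Literature.Analysis.UnboundedOperators.heatKernel τ z ≤
      (Nat.factorial k * (8 * τ) ^ k) * ((4 * π * τ) ^ (-(Module.finrank ℝ ZM : ℝ) / 2) *
        Real.exp (-(1 / (8 * τ)) * ‖z‖ ^ 2)) := by
  rw [heatKernel_eq]
  set c : ℝ := (4 * π * τ) ^ (-(Module.finrank ℝ ZM : ℝ) / 2) with hc
  have hc0 : 0 ≤ c := by positivity
  have hs0 : 0 ≤ ‖z‖ ^ 2 / (8 * τ) := by positivity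
  -- `s^k/k! ≤ e^s`
  have h1 := Real.pow_div_factorial_le_exp (‖z‖ ^ 2 / (8 * τ)) hs0 k
  have hk : (0 : ℝ) < Nat.factorial k := by exact_mod_cast Nat.factorial_pos k
  rw [div_le_iff₀ hk] at h1
  have h2 : ‖z‖ ^ (2 * k) = (8 * τ) ^ k * (‖z‖ ^ 2 / (8 * τ)) ^ k := by
    rw [pow_mul, ← mul_pow]; congr 1; field_simp
  have hsplit : Real.exp (-(1 / (4 * τ)) * ‖z‖ ^ 2) =
      Real.exp (-(‖z‖ ^ 2 / (8 * τ))) * Real.exp (-(1 / (8 * τ)) * ‖z‖ ^ 2) := by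
    rw [← Real.exp_add]; congr 1; field_simp; ring
  have hee : (‖z‖ ^ 2 / (8 * τ)) ^ k * Real.exp (-(‖z‖ ^ 2 / (8 * τ))) ≤ Nat.factorial k := by
    rw [Real.exp_neg, ← div_eq_mul_inv, div_le_iff₀ (Real.exp_pos _)]
    linarith
  calc ‖z‖ ^ (2 * k) * (c * Real.exp (-(1 / (4 * τ)) * ‖z‖ ^ 2))
      = (8 * τ) ^ k * c * (((‖z‖ ^ 2 / (8 * τ)) ^ k * Real.exp (-(‖z‖ ^ 2 / (8 * τ)))) *
          Real.exp (-(1 / (8 * τ)) * ‖z‖ ^ 2)) := by rw [h2, hsplit]; ring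
    _ ≤ (8 * τ) ^ k * c * ((Nat.factorial k : ℝ) * Real.exp (-(1 / (8 * τ)) * ‖z‖ ^ 2)) := by
        gcongr
    _ = _ := by ring

/-- The Gaussian `(4πτ)^{−9/2} e^{−‖z‖²/(8τ)}` has mass `2^{9/2} ≤ 32`. [folklore] -/
theorem integral_gaussian_eighth_le {τ : ℝ} (hτ : 0 < τ) :
    ∫ z : ZM, (4 * π * τ) ^ (-(Module.finrank ℝ ZM : ℝ) / 2) * Real.exp (-(1 / (8 * τ)) * ‖z‖ ^ 2) ≤ 32 := by
  have hb : 0 < 1 / (8 * τ) := by positivity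
  have hA : 0 < (4 * π * τ) := by positivity
  rw [integral_const_mul, GaussianFourier.integral_rexp_neg_mul_sq_norm hb, finrank_ZM]
  have h8 : π / (1 / (8 * τ)) = 2 * (4 * π * τ) := by field_simp; ring
  have e2 : (2 * (4 * π * τ)) ^ (((9 : ℕ) : ℝ) / 2) = (2 : ℝ) ^ (((9 : ℕ) : ℝ) / 2) * (4 * π * τ) ^ (((9 : ℕ) : ℝ) / 2) :=
    Real.mul_rpow (by norm_num) hA.le
  have e3 : (4 * π * τ) ^ (-((9 : ℕ) : ℝ) / 2) = ((4 * π * τ) ^ (((9 : ℕ) : ℝ) / 2))⁻¹ := by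
    rw [show -((9 : ℕ) : ℝ) / 2 = -(((9 : ℕ) : ℝ) / 2) by ring, Real.rpow_neg hA.le]
  have hB : 0 < (4 * π * τ) ^ (((9 : ℕ) : ℝ) / 2) := Real.rpow_pos_of_pos hA _
  rw [h8, e2, e3, ← mul_assoc, mul_comm ((4 * π * τ) ^ (((9 : ℕ) : ℝ) / 2))⁻¹, mul_assoc, inv_mul_cancel₀ hB.ne', mul_one]
  calc (2 : ℝ) ^ (((9 : ℕ) : ℝ) / 2) ≤ (2 : ℝ) ^ ((5 : ℕ) : ℝ) :=
        Real.rpow_le_rpow_of_exponent_le (by norm_num) (by norm_num)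
    _ = 32 := by rw [Real.rpow_natCast]; norm_num

/-- `‖z‖^{2k} G_τ(z)` is integrable on `ZM` (`0 < τ`). [folklore] -/
theorem integrable_norm_pow_mul_heatKernelUO {τ : ℝ} (hτ : 0 < τ) (k : ℕ) :
    Integrable fun z : ZM => ‖z‖ ^ (2 * k) * Literature.Analysis.UnboundedOperators.heatKernel τ z := by
  have hb : 0 < 1 / (8 * τ) := by positivity
  refine (((Literature.Analysis.UnboundedOperators.integrable_gaussian_of_pos (E := ZM) hb).const_mul
    ((4 * π * τ) ^ (-(Module.finrank ℝ ZM : ℝ) / 2))).const_mul (Nat.factorial k * (8 * τ) ^ k)).mono' ?_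
    (Eventually.of_forall fun z => ?_)
  · exact ((continuous_norm.pow _).mul (Literature.Analysis.UnboundedOperators.continuous_heatKernel τ)).aestronglyMeasurable
  · rw [Real.norm_of_nonneg (mul_nonneg (pow_nonneg (norm_nonneg _) _)
      (Literature.Analysis.UnboundedOperators.heatKernel_pos hτ z).le)]
    exact norm_pow_mul_heatKernelUO_le hτ k z

/-- **Even moments**: `∫ G_τ(z) ‖z‖^{2k} dz ≤ 32 · k! · (8τ)^k` on `ZM` (`0 < τ`). [folklore] -/
theorem integral_norm_pow_mul_heatKernelUO_le {τ : ℝ} (hτ : 0 < τ) (k : ℕ) :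
    ∫ z : ZM, ‖z‖ ^ (2 * k) * Literature.Analysis.UnboundedOperators.heatKernel τ z ≤
      32 * (Nat.factorial k * (8 * τ) ^ k) := by
  have hb : 0 < 1 / (8 * τ) := by positivity
  have hI : Integrable fun z : ZM => (Nat.factorial k * (8 * τ) ^ k) * ((4 * π * τ) ^ (-(Module.finrank ℝ ZM : ℝ) / 2) *
      Real.exp (-(1 / (8 * τ)) * ‖z‖ ^ 2)) :=
    ((Literature.Analysis.UnboundedOperators.integrable_gaussian_of_pos (E := ZM) hb).const_mul _).const_mul _
  calc ∫ z : ZM, ‖z‖ ^ (2 * k) * Literature.Analysis.UnboundedOperators.heatKernel τ z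
      ≤ ∫ z : ZM, (Nat.factorial k * (8 * τ) ^ k) * ((4 * π * τ) ^ (-(Module.finrank ℝ ZM : ℝ) / 2) *
          Real.exp (-(1 / (8 * τ)) * ‖z‖ ^ 2)) :=
        integral_mono_of_nonneg (Eventually.of_forall fun z => mul_nonneg (pow_nonneg (norm_nonneg _) _)
          (Literature.Analysis.UnboundedOperators.heatKernel_pos hτ z).le) hI
          (Eventually.of_forall fun z => norm_pow_mul_heatKernelUO_le hτ k z)
    _ = (Nat.factorial k * (8 * τ) ^ k) * ∫ z : ZM, (4 * π * τ) ^ (-(Module.finrank ℝ ZM : ℝ) / 2) *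
          Real.exp (-(1 / (8 * τ)) * ‖z‖ ^ 2) := integral_const_mul _ _
    _ ≤ (Nat.factorial k * (8 * τ) ^ k) * 32 :=
        mul_le_mul_of_nonneg_left (integral_gaussian_eighth_le hτ) (by positivity)
    _ = 32 * (Nat.factorial k * (8 * τ) ^ k) := by ring

end Moments

/-! ### §2. The second difference of the potential -/

section SecondDifference

/-- The colour Gram entries `x_i · x_j`. [folklore] -/
theorem colourVec_add (y z : ZM) (i : Fin 3) : colourVec (y + z) i = colourVec y i + colourVec z i := by
  funext a; simp [colourVec]

/-- `(y − z)_i = y_i − z_i`. [folklore] -/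
theorem colourVec_sub (y z : ZM) (i : Fin 3) : colourVec (y - z) i = colourVec y i - colourVec z i := by
  funext a; simp [colourVec]

/-- `4V(x) = ‖x‖⁴ − Σ_{ij} (x_i·x_j)²` (Lagrange's identity summed). [folklore] -/
theorem four_mul_luscherPotential (x : ZM) :
    4 * luscherPotential x = ‖x‖ ^ 4 - ∑ i, ∑ j, (colourVec x i ⬝ᵥ colourVec x j) ^ 2 := by
  rw [luscherPotential_eq_sum_crossSq]
  have hn : ‖x‖ ^ 4 = (∑ i, csq i x) * ∑ j, csq j x := by
    rw [show (4:ℕ) = 2 * 2 from rfl, pow_mul, norm_sq_eq_sum_csq, sq]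
  rw [hn, Finset.sum_mul_sum, ← Finset.sum_sub_distrib]
  have e : ∀ i, (∑ j, csq i x * csq j x) - ∑ j, (colourVec x i ⬝ᵥ colourVec x j) ^ 2 =
      ∑ j, crossSq i j x := fun i => by
    rw [← Finset.sum_sub_distrib]
    refine Finset.sum_congr rfl fun j _ => ?_
    rw [crossSq, cross_dot_cross, csq, csq, dotProduct_comm (colourVec x j) (colourVec x i), sq]
  simp_rw [e]
  ring

/-- The Gram entry of `y + z`. [folklore] -/
theorem gram_add (y z : ZM) (i j : Fin 3) :
    colourVec (y + z) i ⬝ᵥ colourVec (y + z) j =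
      colourVec y i ⬝ᵥ colourVec y j + (colourVec y i ⬝ᵥ colourVec z j + colourVec z i ⬝ᵥ colourVec y j)
        + colourVec z i ⬝ᵥ colourVec z j := by
  rw [colourVec_add, colourVec_add, add_dotProduct, dotProduct_add, dotProduct_add]
  ring

/-- The Gram entry of `y − z`. [folklore] -/
theorem gram_sub (y z : ZM) (i j : Fin 3) :
    colourVec (y - z) i ⬝ᵥ colourVec (y - z) j =
      colourVec y i ⬝ᵥ colourVec y j - (colourVec y i ⬝ᵥ colourVec z j + colourVec z i ⬝ᵥ colourVec y j)
        + colourVec z i ⬝ᵥ colourVec z j := by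
  rw [colourVec_sub, colourVec_sub, sub_dotProduct, dotProduct_sub, dotProduct_sub]
  ring

/-- `Σ_{ij} (y_i·y_j)(z_i·z_j) = Σ_{ab} (Σ_i y_{ia} z_{ib})² ≥ 0` (trace of a product of Gram matrices). [folklore] -/
theorem sum_gram_mul_gram_nonneg (y z : ZM) :
    0 ≤ ∑ i, ∑ j, (colourVec y i ⬝ᵥ colourVec y j) * (colourVec z i ⬝ᵥ colourVec z j) := by
  have e : ∑ i, ∑ j, (colourVec y i ⬝ᵥ colourVec y j) * (colourVec z i ⬝ᵥ colourVec z j) =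
      ∑ a : Fin 3, ∑ b : Fin 3, (∑ i : Fin 3, y (i, a) * z (i, b)) * ∑ j : Fin 3, y (j, a) * z (j, b) := by
    -- both sides are `Σ_{i,j,a,b} y_ia y_ja z_ib z_jb`
    have lhs : ∀ i j : Fin 3, (colourVec y i ⬝ᵥ colourVec y j) * (colourVec z i ⬝ᵥ colourVec z j) =
        ∑ a, ∑ b, (y (i, a) * z (i, b)) * (y (j, a) * z (j, b)) := fun i j => by
      simp only [dotProduct, colourVec]
      rw [Finset.sum_mul_sum]
      exact Finset.sum_congr rfl fun a _ => Finset.sum_congr rfl fun b _ => by ring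
    have rhs : ∀ a b : Fin 3, (∑ i : Fin 3, y (i, a) * z (i, b)) * (∑ j : Fin 3, y (j, a) * z (j, b)) =
        ∑ i, ∑ j, (y (i, a) * z (i, b)) * (y (j, a) * z (j, b)) := fun a b => Finset.sum_mul_sum _ _ _ _
    simp_rw [lhs, rhs]
    -- reorder `Σ_i Σ_j Σ_a Σ_b` into `Σ_a Σ_b Σ_i Σ_j`
    calc ∑ i : Fin 3, ∑ j : Fin 3, ∑ a : Fin 3, ∑ b : Fin 3, y (i, a) * z (i, b) * (y (j, a) * z (j, b))
        = ∑ i : Fin 3, ∑ a : Fin 3, ∑ j : Fin 3, ∑ b : Fin 3, y (i, a) * z (i, b) * (y (j, a) * z (j, b)) :=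
          Finset.sum_congr rfl fun i _ => Finset.sum_comm
      _ = ∑ a : Fin 3, ∑ i : Fin 3, ∑ j : Fin 3, ∑ b : Fin 3, y (i, a) * z (i, b) * (y (j, a) * z (j, b)) :=
          Finset.sum_comm
      _ = ∑ a : Fin 3, ∑ i : Fin 3, ∑ b : Fin 3, ∑ j : Fin 3, y (i, a) * z (i, b) * (y (j, a) * z (j, b)) :=
          Finset.sum_congr rfl fun a _ => Finset.sum_congr rfl fun i _ => Finset.sum_comm
      _ = ∑ a : Fin 3, ∑ b : Fin 3, ∑ i : Fin 3, ∑ j : Fin 3, y (i, a) * z (i, b) * (y (j, a) * z (j, b)) :=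
          Finset.sum_congr rfl fun a _ => Finset.sum_comm
  rw [e]
  exact Finset.sum_nonneg fun a _ => Finset.sum_nonneg fun b _ => by rw [← sq]; exact sq_nonneg _

/-- `|x_i · x_j| ≤ ‖x‖²`-type bound: `Σ_{ij} (z_i·z_j)² ≤ ‖z‖⁴`. [folklore] -/
theorem sum_gram_sq_le (z : ZM) : ∑ i, ∑ j, (colourVec z i ⬝ᵥ colourVec z j) ^ 2 ≤ ‖z‖ ^ 4 := by
  have h := four_mul_luscherPotential z
  linarith [luscherPotential_nonneg z]

/-- **Second difference of the potential**: `V(y+z) + V(y−z) − 2V(y) ≤ 3‖y‖²‖z‖² + ½‖z‖⁴`. [folklore] -/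
theorem luscherPotential_add_add_sub_le (y z : ZM) :
    luscherPotential (y + z) + luscherPotential (y - z) - 2 * luscherPotential y ≤
      3 * ‖y‖ ^ 2 * ‖z‖ ^ 2 + (1 / 2 : ℝ) * ‖z‖ ^ 4 := by
  have h1 := four_mul_luscherPotential (y + z)
  have h2 := four_mul_luscherPotential (y - z)
  have h3 := four_mul_luscherPotential y
  -- norms
  have hn1 : ‖y + z‖ ^ 2 = ‖y‖ ^ 2 + 2 * inner ℝ y z + ‖z‖ ^ 2 := norm_add_sq_real y z
  have hn2 : ‖y - z‖ ^ 2 = ‖y‖ ^ 2 - 2 * inner ℝ y z + ‖z‖ ^ 2 := norm_sub_sq_real y z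
  have hin : |inner ℝ y z| ≤ ‖y‖ * ‖z‖ := abs_real_inner_le_norm y z
  have hin2 : (inner ℝ y z) ^ 2 ≤ ‖y‖ ^ 2 * ‖z‖ ^ 2 := by
    rw [← sq_abs, ← mul_pow]; exact pow_le_pow_left₀ (abs_nonneg _) hin 2
  have h4p : ‖y + z‖ ^ 4 = (‖y + z‖ ^ 2) ^ 2 := by ring
  have h4m : ‖y - z‖ ^ 4 = (‖y - z‖ ^ 2) ^ 2 := by ring
  -- Gram sums: the cross-term identity
  set a : Fin 3 → Fin 3 → ℝ := fun i j => colourVec y i ⬝ᵥ colourVec y j with ha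
  set b : Fin 3 → Fin 3 → ℝ := fun i j => colourVec y i ⬝ᵥ colourVec z j + colourVec z i ⬝ᵥ colourVec y j with hb
  set c : Fin 3 → Fin 3 → ℝ := fun i j => colourVec z i ⬝ᵥ colourVec z j with hc
  have hG : (∑ i, ∑ j, (colourVec (y + z) i ⬝ᵥ colourVec (y + z) j) ^ 2)
      + (∑ i, ∑ j, (colourVec (y - z) i ⬝ᵥ colourVec (y - z) j) ^ 2)
      - 2 * ∑ i, ∑ j, (colourVec y i ⬝ᵥ colourVec y j) ^ 2 =
      4 * (∑ i, ∑ j, a i j * c i j) + 2 * (∑ i, ∑ j, c i j ^ 2) + 2 * ∑ i, ∑ j, b i j ^ 2 := by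
    simp only [gram_add, gram_sub, ha, hb, hc, Finset.mul_sum, ← Finset.sum_add_distrib, ← Finset.sum_sub_distrib]
    refine Finset.sum_congr rfl fun i _ => Finset.sum_congr rfl fun j _ => ?_
    ring
  have hac : 0 ≤ ∑ i, ∑ j, a i j * c i j := sum_gram_mul_gram_nonneg y z
  have hcc : 0 ≤ ∑ i, ∑ j, c i j ^ 2 := Finset.sum_nonneg fun i _ => Finset.sum_nonneg fun j _ => sq_nonneg _
  have hbb : 0 ≤ ∑ i, ∑ j, b i j ^ 2 := Finset.sum_nonneg fun i _ => Finset.sum_nonneg fun j _ => sq_nonneg _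
  have hy := norm_nonneg y
  have hz := norm_nonneg z
  nlinarith [mul_nonneg (sq_nonneg ‖y‖) (sq_nonneg ‖z‖)]

end SecondDifference

/-! ### §3. Gaussian smoothing of the potential -/

section Smoothing

/-- `V(x) ≤ 2(‖y‖⁴ + ‖z‖⁴)` at `x = y ± z`-type points: `V(x) ≤ ¼‖x‖⁴` and `‖y + w‖⁴ ≤ 8(‖y‖⁴ + ‖w‖⁴)`. [folklore] -/
theorem luscherPotential_add_le (y w : ZM) : luscherPotential (y + w) ≤ 2 * (‖y‖ ^ 4 + ‖w‖ ^ 4) := by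
  have h := luscherPotential_le_norm_pow_four (y + w)
  have ht : ‖y + w‖ ≤ ‖y‖ + ‖w‖ := norm_add_le y w
  have h4 : ‖y + w‖ ^ 4 ≤ (‖y‖ + ‖w‖) ^ 4 := pow_le_pow_left₀ (norm_nonneg _) ht 4
  have hy := norm_nonneg y; have hw := norm_nonneg w
  nlinarith [sq_nonneg (‖y‖ - ‖w‖), sq_nonneg (‖y‖ + ‖w‖), mul_nonneg hy hw, sq_nonneg (‖y‖ ^ 2 - ‖w‖ ^ 2)]

/-- `z ↦ G_τ(z) V(y + z)` and `z ↦ G_τ(z) V(y − z)` are integrable. [folklore] -/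
theorem integrable_heatKernelUO_mul_potential_shift {τ : ℝ} (hτ : 0 < τ) (y : ZM) (ε : ℝ) (hε : ε = 1 ∨ ε = -1) :
    Integrable fun z : ZM => Literature.Analysis.UnboundedOperators.heatKernel τ z * luscherPotential (y + ε • z) := by
  have hK := Literature.Analysis.UnboundedOperators.integrable_heatKernel_holds (E := ZM) hτ
  have hM := integrable_norm_pow_mul_heatKernelUO hτ 2
  refine ((hK.const_mul (2 * ‖y‖ ^ 4)).add (hM.const_mul 2)).mono' ?_ (Eventually.of_forall fun z => ?_)
  · exact ((Literature.Analysis.UnboundedOperators.continuous_heatKernel τ).fun_mul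
      (continuous_luscherPotential.comp (continuous_const.fun_add (continuous_const.fun_smul continuous_id)))).aestronglyMeasurable
  · have hG := (Literature.Analysis.UnboundedOperators.heatKernel_pos hτ z).le
    rw [Real.norm_of_nonneg (mul_nonneg hG (luscherPotential_nonneg _))]
    have hV := luscherPotential_add_le y (ε • z)
    have hεz : ‖ε • z‖ = ‖z‖ := by
      rcases hε with h | h <;> simp [h]
    rw [hεz] at hV
    show _ ≤ 2 * ‖y‖ ^ 4 * Literature.Analysis.UnboundedOperators.heatKernel τ z +
      2 * (‖z‖ ^ (2 * 2) * Literature.Analysis.UnboundedOperators.heatKernel τ z)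
    calc Literature.Analysis.UnboundedOperators.heatKernel τ z * luscherPotential (y + ε • z)
        ≤ Literature.Analysis.UnboundedOperators.heatKernel τ z * (2 * (‖y‖ ^ 4 + ‖z‖ ^ 4)) :=
          mul_le_mul_of_nonneg_left hV hG
      _ = 2 * ‖y‖ ^ 4 * Literature.Analysis.UnboundedOperators.heatKernel τ z +
          2 * (‖z‖ ^ (2 * 2) * Literature.Analysis.UnboundedOperators.heatKernel τ z) := by ring

/-- **Gaussian smoothing of the potential** (sloppy constants): for `0 < s`,
`(P_s V)(y) ≤ V(y) + 54 s ‖y‖² + 144 s²`.  (Symmetrise `z ↦ −z`, bound the second difference by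
`3‖y‖²‖z‖² + ½‖z‖⁴`, and use the moments `∫G_{s/2}‖z‖² ≤ 128 s`, `∫G_{s/2}‖z‖⁴ ≤ 1024 s²`; any constants
are absorbed downstream by the choice of the spectral window.) [folklore] -/
theorem heatSmooth_potential_le {s : ℝ} (hs : 0 < s) (y : ZM) :
    heatSmooth s luscherPotential y ≤ luscherPotential y + 192 * s * ‖y‖ ^ 2 + 256 * s ^ 2 := by
  have hτ : 0 < s / 2 := half_pos hs
  rw [heatSmooth_eq_heatExtension, Literature.Analysis.UnboundedOperators.heatExtension_apply]
  simp only [smul_eq_mul]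
  -- the two shifted integrals
  have Ip : Integrable fun z : ZM => Literature.Analysis.UnboundedOperators.heatKernel (s / 2) z * luscherPotential (y + z) := by
    simpa using integrable_heatKernelUO_mul_potential_shift hτ y 1 (Or.inl rfl)
  have Im : Integrable fun z : ZM => Literature.Analysis.UnboundedOperators.heatKernel (s / 2) z * luscherPotential (y - z) := by
    have h := integrable_heatKernelUO_mul_potential_shift hτ y (-1) (Or.inr rfl)
    refine h.congr (Eventually.of_forall fun z => ?_)
    simp [sub_eq_add_neg]
  -- symmetrisation: `∫ G(z) V(y − z) = ∫ G(z) V(y + z)`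
  have hsym : ∫ z : ZM, Literature.Analysis.UnboundedOperators.heatKernel (s / 2) z * luscherPotential (y - z) =
      ∫ z : ZM, Literature.Analysis.UnboundedOperators.heatKernel (s / 2) z * luscherPotential (y + z) := by
    have h := integral_neg_eq_self
      (fun z : ZM => Literature.Analysis.UnboundedOperators.heatKernel (s / 2) z * luscherPotential (y + z)) volume
    rw [← h]
    refine integral_congr_ae (Eventually.of_forall fun z => ?_)
    simp only [Literature.Analysis.UnboundedOperators.heatKernel_neg, sub_eq_add_neg]
  -- `2 ∫ G V(y−·) = ∫ G [V(y+z) + V(y−z)] ≤ ∫ G [2V(y) + 3‖y‖²‖z‖² + ½‖z‖⁴]`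
  have hK := Literature.Analysis.UnboundedOperators.integrable_heatKernel_holds (E := ZM) hτ
  have hM1 := integrable_norm_pow_mul_heatKernelUO hτ 1
  have hM2 := integrable_norm_pow_mul_heatKernelUO hτ 2
  have hbound : ∀ z : ZM, Literature.Analysis.UnboundedOperators.heatKernel (s / 2) z * luscherPotential (y + z) +
      Literature.Analysis.UnboundedOperators.heatKernel (s / 2) z * luscherPotential (y - z) ≤
      2 * luscherPotential y * Literature.Analysis.UnboundedOperators.heatKernel (s / 2) z +
        3 * ‖y‖ ^ 2 * (‖z‖ ^ (2 * 1) * Literature.Analysis.UnboundedOperators.heatKernel (s / 2) z) +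
        (1 / 2 : ℝ) * (‖z‖ ^ (2 * 2) * Literature.Analysis.UnboundedOperators.heatKernel (s / 2) z) := by
    intro z
    have hG := (Literature.Analysis.UnboundedOperators.heatKernel_pos hτ z).le
    have hS := luscherPotential_add_add_sub_le y z
    have h := mul_le_mul_of_nonneg_left hS hG
    simp only [mul_one]
    nlinarith [h]
  have hint2 : (∫ z : ZM, Literature.Analysis.UnboundedOperators.heatKernel (s / 2) z * luscherPotential (y + z)) +
      ∫ z : ZM, Literature.Analysis.UnboundedOperators.heatKernel (s / 2) z * luscherPotential (y - z) ≤
      2 * luscherPotential y + 3 * ‖y‖ ^ 2 * (32 * (Nat.factorial 1 * (8 * (s / 2)) ^ 1)) +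
        (1 / 2 : ℝ) * (32 * (Nat.factorial 2 * (8 * (s / 2)) ^ 2)) := by
    rw [← integral_add Ip Im]
    have I1 : Integrable fun z : ZM => 2 * luscherPotential y * Literature.Analysis.UnboundedOperators.heatKernel (s / 2) z :=
      hK.const_mul _
    have I2 : Integrable fun z : ZM => 3 * ‖y‖ ^ 2 * (‖z‖ ^ (2 * 1) * Literature.Analysis.UnboundedOperators.heatKernel (s / 2) z) :=
      hM1.const_mul _
    have I3 : Integrable fun z : ZM => (1 / 2 : ℝ) * (‖z‖ ^ (2 * 2) * Literature.Analysis.UnboundedOperators.heatKernel (s / 2) z) :=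
      hM2.const_mul _
    have I12 : Integrable fun z : ZM => 2 * luscherPotential y * Literature.Analysis.UnboundedOperators.heatKernel (s / 2) z +
        3 * ‖y‖ ^ 2 * (‖z‖ ^ (2 * 1) * Literature.Analysis.UnboundedOperators.heatKernel (s / 2) z) := I1.add I2
    have hI : Integrable fun z : ZM => 2 * luscherPotential y * Literature.Analysis.UnboundedOperators.heatKernel (s / 2) z +
        3 * ‖y‖ ^ 2 * (‖z‖ ^ (2 * 1) * Literature.Analysis.UnboundedOperators.heatKernel (s / 2) z) +
        (1 / 2 : ℝ) * (‖z‖ ^ (2 * 2) * Literature.Analysis.UnboundedOperators.heatKernel (s / 2) z) := I12.add I3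
    have IPM : Integrable fun z : ZM => Literature.Analysis.UnboundedOperators.heatKernel (s / 2) z * luscherPotential (y + z) +
        Literature.Analysis.UnboundedOperators.heatKernel (s / 2) z * luscherPotential (y - z) := Ip.add Im
    refine (integral_mono IPM hI hbound).trans ?_
    rw [integral_add I12 I3, integral_add I1 I2, integral_const_mul, integral_const_mul, integral_const_mul,
      Literature.Analysis.UnboundedOperators.integral_heatKernel_eq_one_holds hτ, mul_one]
    have m1 := integral_norm_pow_mul_heatKernelUO_le hτ 1
    have m2 := integral_norm_pow_mul_heatKernelUO_le hτ 2
    have hy2 : 0 ≤ 3 * ‖y‖ ^ 2 := by positivity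
    nlinarith [mul_le_mul_of_nonneg_left m1 hy2, m2]
  rw [hsym] at hint2
  have hf1 : (Nat.factorial 1 : ℝ) = 1 := by norm_num
  have hf2 : (Nat.factorial 2 : ℝ) = 2 := by norm_num
  rw [hf1, hf2] at hint2
  have e : ∫ z : ZM, Literature.Analysis.UnboundedOperators.heatKernel (s / 2) z * luscherPotential (y - z) =
      ∫ z : ZM, Literature.Analysis.UnboundedOperators.heatKernel (s / 2) z * luscherPotential (y + z) := hsym
  rw [e]
  nlinarith [hint2]

end Smoothing

end Summit.QuantumFields.YangMills.Theorems.FemtoTransferGap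

end
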